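import Mathlib

/-!
# Field-theoretic tools for the hard core of the sweep: embeddings realising points with the same
# relations, conjugation of roots, transport of polynomial relations

For a tuple `w : σ → ℂ` let `F₁ = ℚ(w)` and `L = F₁^alg ∩ ℂ` (the relative algebraic closure of
`F₁` in `ℂ`, an algebraic closure of `F₁`).

* `aeval_ringHom_comp` — a ring homomorphism transports `ℚ`-polynomial relations;
* `exists_ringHom_apply_eq` — if `w' : σ → ℂ` satisfies exactly the same `ℚ`-polynomial relations
  as `w`, there is a ring homomorphism `ω : L → ℂ` with `ω(wⱼ) = w'ⱼ` (`ℚ[w] ≅ ℚ[w'] ⊆ ℂ`,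
  extended to the fraction field `F₁` and then to `L` by `IsAlgClosed.lift`);
* `exists_algEquiv_apply_eq_of_aeval_minpoly` — the roots in `L` of the minimal polynomial of
  `c ∈ L` over `F₁` are `Aut(L/F₁)`-conjugates of `c` (`L/F₁` is normal);
* `roots_map_eq_of_splits` — the roots of the image of a split polynomial under a ring
  homomorphism into a field are the images of the roots.

## References

* [Lang2002] S. Lang, *Algebra*, 3rd ed., GTM 211, Ch. V §2 (extension of embeddings into
  algebraically closed fields, Thm 2.8; conjugates and automorphisms of a normal extension).
-/

noncomputable section

open Polynomial

namespace Literature.NumberTheory.Transcendental.Fields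

open scoped IntermediateField.algebraAdjoinAdjoin

variable {σ : Type*}

/-- A ring homomorphism between `ℚ`-algebras transports evaluations of `ℚ`-polynomials. [folklore]
-/
theorem aeval_ringHom_comp {A B : Type*} [CommRing A] [CommRing B] [Algebra ℚ A] [Algebra ℚ B]
    (χ : A →+* B) (u : σ → A) (p : MvPolynomial σ ℚ) :
    MvPolynomial.aeval (fun j => χ (u j)) p = χ (MvPolynomial.aeval u p) := by
  have := MvPolynomial.comp_aeval_apply χ.toRatAlgHom (f := u) p
  simpa only [RingHom.toRatAlgHom_apply] using this.symm

/-- The generators `wⱼ` as elements of `ℚ(w)`. [folklore] -/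
theorem mem_adjoin_range (w : σ → ℂ) (j : σ) :
    w j ∈ IntermediateField.adjoin ℚ (Set.range w) :=
  IntermediateField.subset_adjoin ℚ _ ⟨j, rfl⟩

/-- **Embeddings realising points with the same relations.** If `w'` satisfies exactly the
`ℚ`-polynomial relations of `w`, then some ring homomorphism `ω : ℚ(w)^alg ∩ ℂ → ℂ` maps `wⱼ` to
`w'ⱼ` for every `j`. [folklore] -/
theorem exists_ringHom_apply_eq (w w' : σ → ℂ)
    (h : ∀ p : MvPolynomial σ ℚ, MvPolynomial.aeval w' p = 0 ↔ MvPolynomial.aeval w p = 0) :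
    ∃ ω : (algebraicClosure (IntermediateField.adjoin ℚ (Set.range w)) ℂ) →+* ℂ,
      ∀ j, ω (algebraMap (IntermediateField.adjoin ℚ (Set.range w))
        (algebraicClosure (IntermediateField.adjoin ℚ (Set.range w)) ℂ)
          ⟨w j, mem_adjoin_range w j⟩) = w' j := by
  classical
  -- `g₀ : ℚ[w] → ℚ(w')`, `aeval w q ↦ aeval w' q`, well defined and injective by `h`
  let lift : (MvPolynomial σ ℚ ⧸ RingHom.ker (MvPolynomial.aeval w : MvPolynomial σ ℚ →ₐ[ℚ] ℂ))
      →ₐ[ℚ] ℂ :=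
    Ideal.Quotient.liftₐ _ (MvPolynomial.aeval w') fun q hq => (h q).2 hq
  have hlift : ∀ q, lift (Ideal.Quotient.mk _ q) = MvPolynomial.aeval w' q := fun q => rfl
  have hlift_inj : Function.Injective lift := by
    rw [injective_iff_map_eq_zero]
    intro q hq
    obtain ⟨q, rfl⟩ := Ideal.Quotient.mk_surjective q
    rw [Ideal.Quotient.eq_zero_iff_mem, RingHom.mem_ker]
    rw [hlift] at hq
    exact (h q).1 hq
  let e := Ideal.quotientKerEquivRange (MvPolynomial.aeval w : MvPolynomial σ ℚ →ₐ[ℚ] ℂ)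
  have hAr : Algebra.adjoin ℚ (Set.range w) =
      (MvPolynomial.aeval w : MvPolynomial σ ℚ →ₐ[ℚ] ℂ).range :=
    (MvPolynomial.aeval_range w).symm
  let g₀ : Algebra.adjoin ℚ (Set.range w) →ₐ[ℚ] ℂ :=
    (lift.comp (e.symm.toAlgHom)).comp (Subalgebra.equivOfEq _ _ hAr).toAlgHom
  have hg₀ : Function.Injective g₀ :=
    hlift_inj.comp (e.symm.injective.comp (Subalgebra.equivOfEq _ _ hAr).injective)
  have hg₀w : ∀ (q : MvPolynomial σ ℚ)
      (hq : MvPolynomial.aeval w q ∈ Algebra.adjoin ℚ (Set.range w)),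
      g₀ ⟨_, hq⟩ = MvPolynomial.aeval w' q := by
    intro q hq
    have h1 : Subalgebra.equivOfEq _ _ hAr ⟨_, hq⟩ = e (Ideal.Quotient.mk _ q) := by
      apply Subtype.ext
      simp [e, Ideal.quotientKerEquivRange]
    show lift (e.symm (Subalgebra.equivOfEq _ _ hAr ⟨_, hq⟩)) = _
    rw [h1, AlgEquiv.symm_apply_apply, hlift]
  -- the values of `g₀` lie in `F₂ = ℚ(w')`
  set F₂ := IntermediateField.adjoin ℚ (Set.range w') with hF₂
  have hg₀mem : ∀ a, g₀ a ∈ F₂ := by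
    rintro ⟨a, ha⟩
    rw [hAr] at ha
    obtain ⟨q, rfl⟩ := ha
    have hq : MvPolynomial.aeval w q ∈ Algebra.adjoin ℚ (Set.range w) := by
      rw [hAr]; exact ⟨q, rfl⟩
    have : g₀ ⟨_, hq⟩ ∈ F₂ := by
      rw [hg₀w q hq]
      refine IntermediateField.algebra_adjoin_le_adjoin ℚ _ ?_
      rw [← MvPolynomial.aeval_range]
      exact ⟨q, rfl⟩
    exact this
  let g₀' : Algebra.adjoin ℚ (Set.range w) →ₐ[ℚ] F₂ := g₀.codRestrict F₂.toSubalgebra hg₀mem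
  have hg₀'v : ∀ a, (g₀' a : ℂ) = g₀ a := fun a => rfl
  have hg₀' : Function.Injective (g₀' : Algebra.adjoin ℚ (Set.range w) →+* F₂) := by
    intro a b hab
    apply hg₀
    have := congrArg (fun t : F₂ => (t : ℂ)) hab
    simpa [hg₀'v] using this
  -- extend to the fraction field `F₁ = ℚ(w)`, with values in `F₂ ⊆ L' = ℚ(w')^alg ∩ ℂ`
  set F₁ := IntermediateField.adjoin ℚ (Set.range w) with hF₁
  let e₂ : F₁ →+* F₂ := IsFractionRing.lift hg₀'
  have he₂ : ∀ a : Algebra.adjoin ℚ (Set.range w), e₂ (algebraMap _ F₁ a) = g₀' a :=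
    fun a => IsFractionRing.lift_algebraMap hg₀' a
  set L' := algebraicClosure F₂ ℂ with hL'
  set L := algebraicClosure F₁ ℂ with hL
  let e₃ : F₁ →+* L' := (algebraMap F₂ L').comp e₂
  -- extend to `L` by `IsAlgClosed.lift` (target `L'`, an `F₁`-algebra through `e₃`)
  haveI : IsAlgClosed L' := IsAlgClosure.isAlgClosed F₂
  obtain ⟨ψ, hψ⟩ : ∃ ψ : L →+* L', ∀ a : F₁, ψ (algebraMap F₁ L a) = e₃ a := by
    letI : Algebra F₁ L' := e₃.toAlgebra
    haveI : Module.IsTorsionFree F₁ L' :=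
      Module.isTorsionFree_iff_algebraMap_injective.2 e₃.injective
    haveI : Module.IsTorsionFree F₁ L :=
      Module.isTorsionFree_iff_algebraMap_injective.2 (algebraMap F₁ L).injective
    let ψ : L →ₐ[F₁] L' := IsAlgClosed.lift
    exact ⟨ψ.toRingHom, fun a => ψ.commutes a⟩
  refine ⟨(algebraMap L' ℂ).comp ψ, fun j => ?_⟩
  have hwA : w j ∈ Algebra.adjoin ℚ (Set.range w) := Algebra.subset_adjoin ⟨j, rfl⟩
  have h2 : (⟨w j, mem_adjoin_range w j⟩ : F₁) =
      algebraMap _ F₁ (⟨w j, hwA⟩ : Algebra.adjoin ℚ _) :=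
    Subtype.ext rfl
  rw [RingHom.comp_apply, hψ, h2]
  show ((e₂ (algebraMap _ F₁ (⟨w j, hwA⟩ : Algebra.adjoin ℚ _)) : F₂) : ℂ) = w' j
  rw [he₂, hg₀'v]
  have hq : MvPolynomial.aeval w (MvPolynomial.X j : MvPolynomial σ ℚ) ∈
      Algebra.adjoin ℚ (Set.range w) := by
    rw [MvPolynomial.aeval_X]; exact hwA
  have := hg₀w (MvPolynomial.X j) hq
  simp only [MvPolynomial.aeval_X] at this
  exact this

/-- **Conjugation of roots.** For `c` in an algebraic closure `L` of `F₁` and a root `θ ∈ L` of the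
minimal polynomial of `c`, some `F₁`-automorphism of `L` maps `c` to `θ`. [folklore] -/
theorem exists_algEquiv_apply_eq_of_aeval_minpoly {F₁ L : Type*} [Field F₁] [Field L]
    [Algebra F₁ L] [IsAlgClosure F₁ L] {c θ : L} (hθ : aeval θ (minpoly F₁ c) = 0) :
    ∃ g : L ≃ₐ[F₁] L, g c = θ := by
  have hc : IsIntegral F₁ c := Algebra.IsIntegral.isIntegral c
  have hconj : IsConjRoot F₁ c θ := isConjRoot_of_aeval_eq_zero hc hθ
  obtain ⟨g, hg⟩ := hconj.symm.exists_algEquiv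
  exact ⟨g, hg⟩

/-- **Roots are transported by ring homomorphisms**: for a polynomial over an algebraically closed
field and a ring homomorphism into a field, the roots of the image are the images of the roots.
[folklore] -/
theorem roots_map_eq {L K : Type*} [Field L] [IsAlgClosed L] [Field K] [DecidableEq K]
    (χ : L →+* K) (Q : Polynomial L) : (Q.map χ).roots = Q.roots.map χ :=
  (IsAlgClosed.splits Q).roots_map χ

end Literature.NumberTheory.Transcendental.Fields

end
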